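import Summits.QuantumFields.YangMills.Theorems.BalabanUVNodesN11NoExpansionGeneralStepIntegrable
import Summits.QuantumFields.YangMills.Theorems.BalabanUVNodesN11NoExpansionGeneralStepCoPHOldBranch

/-!
# DAG node N11 — THE GENERAL-HISTORY NO-EXPANSION 𝐓-STEP UNDER GRAPH-INTEGRABILITY, UP THE CHAIN: p543804's two weight-family theorems, p544575's v1.7
# clause ∕ provisos-keyed theorems and p547524's OLD-BRANCH form, each with the sup-bound binder (`hC` resp. `hCB`) REPLACED by integrability along the averaging
# graph (`hI`) resp. integrability of the old branch (`hIB`) — step four of re-typing the analytic binder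

WHY.  Step four (a) of re-typing the analytic binder (see `…N11TkFullBondTransportIntegrable`): p543804's two weight-family theorems — one family with the
generation-`k` pin and old front factor (`…_of_pinChi_of_clause`), two families agreeing below `k` (`…_of_prefix_of_clause`) — VERBATIM with `hC` replaced by the
graph-integrability binder `hI`; proofs unchanged but for the callee (`…GeneralStepIntegrable`).

WHAT THIS FILE PROVES (0 `sorry`, 0 `def`).  `clause_succ_of_Omega_empty_of_pinChi_of_clause_of_integrable`, ★★ `clause_succ_of_Omega_empty_of_prefix_of_clause_of_integrable`.
Sources: [III] Theorem p. 245, (3.24)–(3.25) p. 270, (2.18) p. 257, (2.20)–(2.23) p. 258, (3.16) p. 268; [Balaban1989LargeFieldI] (0.2)–(0.3) p. 176.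

HONEST SCOPE.  Helper lane of K1⁷ `stmt-QuantumFields-20542` (dag-n11-d g9); [folklore] measure theory (disintegration along Bałaban's averaging of record, `HaarAC`) over the
tree's OWN kernels and records; nothing of Bałaban's estimates is asserted; no binder of an ACCEPTED theorem is edited (new `_of_integrable` theorems stand beside the
bounded ones); director-ym №186 (1) respected (no value law for `Zh` at `k ≥ 1` is posited).  N11 is NOT discharged; counts unmoved (typed 28∕28 · discharged 5∕27).  One
finite four-torus programme at fixed `ε = L^{−K}`; NOT ℝ⁴, NOT OS, NOT a mass gap, NOT Clay.
-/

noncomputable section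

open MeasureTheory
open scoped BigOperators Matrix.Norms.L2Operator

namespace Summit.QuantumFields.YangMills.Theorems.BalabanUVNodesN11NoExpansionGenericWIntegrable

open Literature.MathematicalPhysics.QuantumFieldTheory.Balaban1983to89 T4Continuum Node00 Node00.Tk DagBinding
open B15DeterminingSets
open BalabanUVNodesN11NoExpansionGeneralStepIntegrable (clause_succ_of_zetaSpecChiAt_of_clause_of_integrable)
open BalabanUVNodesN11NoExpansionOldFactors (oldFactors_agree_of_Omega_empty)
open BalabanUVNodesN11TkBranchWeightCongr (sect2Slot_congr_of_weights tkWeightsOfRecordP_ζ_congr tkWeightsOfRecordP_w_congr)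
open BalabanUVNodesN11NoExpansionDiagonalAtZ (tkWeightsOfRecordP_ζ_apply tkWeightsOfRecordP_w_empty tkWeightsOfRecordP_ζ_local)
open BalabanUVNodesN11NoExpansionDiagonalCoPH (WtOfRecord₁₃H_eq_tkWeightsOfRecordP)
open BalabanUVNodesN11NoExpansionGeneralStepCoPH (tkWeightsOfRecordP_w_local_of_quad_local)
open BalabanUVNodesN11NoExpansionGeneralStepCoPHOldBranch (newIntegrand_eq_of_pinChi measurable_chiSeqOfRecord_init)

variable {F : T4Family} {N : ℕ} [NeZero N]

/-! ## §1  One weight family ∕ two families agreeing below `k` (p543804's `…_of_pinChi_of_clause` ∕ `…_of_prefix_of_clause`, graph-integrable form) -/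

section GenericW

variable (θ : Stage13Params F N) (p : B12.RunParams)

/-- **★★ THE NO-EXPANSION 𝐓-STEP AFTER AN ARBITRARY HISTORY, CLAUSE-KEYED, ONE WEIGHT FAMILY.**  `s′` with `Ω_{k+1}(s′) = ∅` (`k < K`, `1 ≤ M`); the §2 dichotomy of
`ρ_k`'s slot at `init s′` for the witness `(t, E₀, U_k(init s′))` and residual `Rz` (`hid`); the weights `k`-local below `k` (`hζloc`, `hwloc`), the old action `k`-local
in the fluctuation argument (`hA`); THE GENERATION-`k` PIN WITH THE OLD FRONT FACTOR on the averaging graph, `ζ_k(T)·w_k(∅,∅,∅)(U,Ū) = χ_k(init s′)(U)·w_k(s′)(U,Ū)`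
(`hζχ`); displayed joint measurability ∕ bound of the new integrand per old branch.  Then the 𝐓-image dichotomy holds at `s′` for THE SAME `t`, `E₀`, the background
`U_{k+1}(s′)` and any residual `Rz′`. [cite: Balaban1988Convergent, Theorem p.245, (3.24)–(3.25) p.270, (2.18) p.257, (2.20)–(2.23) p.258, (3.16) p.268] -/
theorem clause_succ_of_Omega_empty_of_pinChi_of_clause_of_integrable {k : ℕ} (hk : k < p.K) (hM : 1 ≤ θ.τ9.M)
    (s : SeqOfRecord F θ.ν θ.τ9.M (gOfRecord₁₃ F N θ p) p.K (k + 1)) (hΩ : s.Ω (k + 1) = ∅) (W : TkWeights F N (FluctV N) p.K)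
    (hζloc : ∀ j, j < k → ∀ ω ω' : MultiCfg (F.P p.K) (SU N) (FluctV N), (∀ i, i ≤ k → ω i = ω' i) →
      W.ζ j (s.init.Ω (j + 1))ᶜ ω = W.ζ j (s.init.Ω (j + 1))ᶜ ω')
    (hwloc : ∀ (S : ℕ → Set (Site (F.P p.K) 0)) (j : ℕ), j < k → ∀ ω ω' : MultiCfg (F.P p.K) (SU N) (FluctV N), (∀ i, i ≤ k → ω i = ω' i) →
      W.w j (s.init.Λ (j + 1)) ((s.init.Λ (j + 1))ᶜ ∩ s.init.Ω (j + 1)) (S (j + 1)) ω =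
        W.w j (s.init.Λ (j + 1)) ((s.init.Λ (j + 1))ᶜ ∩ s.init.Ω (j + 1)) (S (j + 1)) ω')
    (Rz Rz' : Sect2.Residual (F.P p.K) (MatA N)) (t : Sect2.TermValues (F.P p.K) (MatA N) (FluctV N) θ.τ9.M) (E₀ : ℝ)
    (hA : ∀ (S : ℕ → Set (Site (F.P p.K) 0)) (a a' : Tk.MSFluct (F.P p.K) (FluctV N)) (Uf : GaugeField (F.P p.K) 0 (SU N)), (∀ i, i ≤ k → a i = a' i) →
      (sect2ActionDataOfRecord F N (FluctV N) p.K (settingOfRecord₁₃ F N θ p) Rz s.init t (S, a) E₀).action23 k Uf =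
        (sect2ActionDataOfRecord F N (FluctV N) p.K (settingOfRecord₁₃ F N θ p) Rz s.init t (S, a') E₀).action23 k Uf)
    (hid : slotsOfRecord F N θ.ν θ.τ9 (EOfRecord₁₃ F N θ) (wOfRecord₉ F N θ.toStage9Params) θ.ppSel p (gOfRecord₁₃ F N θ p) k s.init = 0 ∨
      ∀ᵐ U₀ ∂fieldMeasure (F.P p.K) k (SU N),
        chiSeqOfRecord F N θ.ν θ.τ9.M (gOfRecord₁₃ F N θ p) p.K k s.init U₀ ≠ 0 →
          slotsOfRecord F N θ.ν θ.τ9 (EOfRecord₁₃ F N θ) (wOfRecord₉ F N θ.toStage9Params) θ.ppSel p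
              (gOfRecord₁₃ F N θ p) k s.init U₀ =
            sect2Slot F N (FluctV N) p.K (settingOfRecord₁₃ F N θ p) Rz W s.init t E₀ (UbgOfRecord₁₃CoP F N θ p k s.init) U₀)
    (hζχ : ∀ U₀ : GaugeField (F.P p.K) k (SU N),
      W.ζ k Set.univ (pairCfgAt (V := FluctV N) k ((avOfRecord F N p.K k).avg U₀) U₀) *
          W.w k ∅ ∅ ∅ (pairCfgAt (V := FluctV N) k ((avOfRecord F N p.K k).avg U₀) U₀) =
        chiSeqOfRecord F N θ.ν θ.τ9.M (gOfRecord₁₃ F N θ p) p.K k s.init U₀ *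
          wOfRecord₉ F N θ.toStage9Params p (gOfRecord₁₃ F N θ p) k s U₀ ((avOfRecord F N p.K k).avg U₀))
    (hm : ∀ S ∈ admSOfRecord F θ.ν θ.τ9.M (gOfRecord₁₃ F N θ p) p.K k s.init,
      Measurable (Function.uncurry (noExpIntegrandAt F N (FluctV N) p.K k W
        (tkBranchOfRecord F N (FluctV N) θ.ν θ.τ9.M _ p.K W s.init S k
          (fun ω => sect2Operand F N (FluctV N) p.K (settingOfRecord₁₃ F N θ p) Rz' s t E₀ (UbgOfRecord₁₃CoP F N θ p (k + 1) s)
            (S, fun j => (ω j).2) (fun j => (ω j).1))))))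
    (hI : ∀ S ∈ admSOfRecord F θ.ν θ.τ9.M (gOfRecord₁₃ F N θ p) p.K k s.init,
      Integrable (fun U₀ : GaugeField (F.P p.K) k (SU N) => noExpIntegrandAt F N (FluctV N) p.K k W
        (tkBranchOfRecord F N (FluctV N) θ.ν θ.τ9.M _ p.K W s.init S k
          (fun ω => sect2Operand F N (FluctV N) p.K (settingOfRecord₁₃ F N θ p) Rz' s t E₀ (UbgOfRecord₁₃CoP F N θ p (k + 1) s)
            (S, fun j => (ω j).2) (fun j => (ω j).1)))
        ((avOfRecord F N p.K k).avg U₀) U₀) (fieldMeasure (F.P p.K) k (SU N))) :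
    slotsTOfRecord F N θ.ν θ.τ9 (EOfRecord₁₃ F N θ) (wOfRecord₉ F N θ.toStage9Params) θ.ppSel p (gOfRecord₁₃ F N θ p) (k + 1) s = 0 ∨
      ∀ᵐ V' ∂fieldMeasure (F.P p.K) (k + 1) (SU N),
        chiSeqOfRecord F N θ.ν θ.τ9.M (gOfRecord₁₃ F N θ p) p.K (k + 1) s V' ≠ 0 →
          slotsTOfRecord F N θ.ν θ.τ9 (EOfRecord₁₃ F N θ) (wOfRecord₉ F N θ.toStage9Params) θ.ppSel p
              (gOfRecord₁₃ F N θ p) (k + 1) s V' =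
            sect2Slot F N (FluctV N) p.K (settingOfRecord₁₃ F N θ p) Rz' W s t E₀ (UbgOfRecord₁₃CoP F N θ p (k + 1) s) V' := by
  refine clause_succ_of_zetaSpecChiAt_of_clause_of_integrable θ p hk s hΩ W Rz t E₀ (UbgOfRecord₁₃CoP F N θ p k s.init) hid Rz' t E₀
    (UbgOfRecord₁₃CoP F N θ p (k + 1) s) (κ := 1) (c := 1) (one_mul 1) (fun S _ V' U₀ => ?_) (fun U₀ => by rw [hζχ U₀, one_mul]) hm hI
  rw [oldFactors_agree_of_Omega_empty θ p hM s hΩ W hζloc S (hwloc S) Rz Rz' t E₀ E₀ (hA S) V' U₀, sub_self, Real.exp_zero]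


/-- **★★ THE GENERAL STEP ACROSS TWO WEIGHT FAMILIES AGREEING BELOW `k`.**  As §2, with the level-`k` dichotomy at `init s′` stated at the OLD weights `W₀` and
everything at `s′` at the NEW weights `W`, under `∀ j < k, W.ζ j = W₀.ζ j ∧ W.w j = W₀.w j` — the (PC) bridge (p536516: a length-`k` slot reads the weights below
generation `k` only); director-ym №186 (2): at print's witness this agreement is the statement «the component is untouched by R^{(k+1)}».
[cite: Balaban1988Convergent, Theorem p.245, (3.24)–(3.25) p.270, (2.20)–(2.22) p.258; Balaban1989LargeFieldI, (0.2)–(0.3) p.176] -/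
theorem clause_succ_of_Omega_empty_of_prefix_of_clause_of_integrable {k : ℕ} (hk : k < p.K) (hM : 1 ≤ θ.τ9.M)
    (s : SeqOfRecord F θ.ν θ.τ9.M (gOfRecord₁₃ F N θ p) p.K (k + 1)) (hΩ : s.Ω (k + 1) = ∅) (W W₀ : TkWeights F N (FluctV N) p.K)
    (hpre : ∀ j, j < k → W.ζ j = W₀.ζ j ∧ W.w j = W₀.w j)
    (hζloc : ∀ j, j < k → ∀ ω ω' : MultiCfg (F.P p.K) (SU N) (FluctV N), (∀ i, i ≤ k → ω i = ω' i) →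
      W.ζ j (s.init.Ω (j + 1))ᶜ ω = W.ζ j (s.init.Ω (j + 1))ᶜ ω')
    (hwloc : ∀ (S : ℕ → Set (Site (F.P p.K) 0)) (j : ℕ), j < k → ∀ ω ω' : MultiCfg (F.P p.K) (SU N) (FluctV N), (∀ i, i ≤ k → ω i = ω' i) →
      W.w j (s.init.Λ (j + 1)) ((s.init.Λ (j + 1))ᶜ ∩ s.init.Ω (j + 1)) (S (j + 1)) ω =
        W.w j (s.init.Λ (j + 1)) ((s.init.Λ (j + 1))ᶜ ∩ s.init.Ω (j + 1)) (S (j + 1)) ω')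
    (Rz Rz' : Sect2.Residual (F.P p.K) (MatA N)) (t : Sect2.TermValues (F.P p.K) (MatA N) (FluctV N) θ.τ9.M) (E₀ : ℝ)
    (hA : ∀ (S : ℕ → Set (Site (F.P p.K) 0)) (a a' : Tk.MSFluct (F.P p.K) (FluctV N)) (Uf : GaugeField (F.P p.K) 0 (SU N)), (∀ i, i ≤ k → a i = a' i) →
      (sect2ActionDataOfRecord F N (FluctV N) p.K (settingOfRecord₁₃ F N θ p) Rz s.init t (S, a) E₀).action23 k Uf =
        (sect2ActionDataOfRecord F N (FluctV N) p.K (settingOfRecord₁₃ F N θ p) Rz s.init t (S, a') E₀).action23 k Uf)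
    (hid : slotsOfRecord F N θ.ν θ.τ9 (EOfRecord₁₃ F N θ) (wOfRecord₉ F N θ.toStage9Params) θ.ppSel p (gOfRecord₁₃ F N θ p) k s.init = 0 ∨
      ∀ᵐ U₀ ∂fieldMeasure (F.P p.K) k (SU N),
        chiSeqOfRecord F N θ.ν θ.τ9.M (gOfRecord₁₃ F N θ p) p.K k s.init U₀ ≠ 0 →
          slotsOfRecord F N θ.ν θ.τ9 (EOfRecord₁₃ F N θ) (wOfRecord₉ F N θ.toStage9Params) θ.ppSel p
              (gOfRecord₁₃ F N θ p) k s.init U₀ =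
            sect2Slot F N (FluctV N) p.K (settingOfRecord₁₃ F N θ p) Rz W₀ s.init t E₀ (UbgOfRecord₁₃CoP F N θ p k s.init) U₀)
    (hζχ : ∀ U₀ : GaugeField (F.P p.K) k (SU N),
      W.ζ k Set.univ (pairCfgAt (V := FluctV N) k ((avOfRecord F N p.K k).avg U₀) U₀) *
          W.w k ∅ ∅ ∅ (pairCfgAt (V := FluctV N) k ((avOfRecord F N p.K k).avg U₀) U₀) =
        chiSeqOfRecord F N θ.ν θ.τ9.M (gOfRecord₁₃ F N θ p) p.K k s.init U₀ *
          wOfRecord₉ F N θ.toStage9Params p (gOfRecord₁₃ F N θ p) k s U₀ ((avOfRecord F N p.K k).avg U₀))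
    (hm : ∀ S ∈ admSOfRecord F θ.ν θ.τ9.M (gOfRecord₁₃ F N θ p) p.K k s.init,
      Measurable (Function.uncurry (noExpIntegrandAt F N (FluctV N) p.K k W
        (tkBranchOfRecord F N (FluctV N) θ.ν θ.τ9.M _ p.K W s.init S k
          (fun ω => sect2Operand F N (FluctV N) p.K (settingOfRecord₁₃ F N θ p) Rz' s t E₀ (UbgOfRecord₁₃CoP F N θ p (k + 1) s)
            (S, fun j => (ω j).2) (fun j => (ω j).1))))))
    (hI : ∀ S ∈ admSOfRecord F θ.ν θ.τ9.M (gOfRecord₁₃ F N θ p) p.K k s.init,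
      Integrable (fun U₀ : GaugeField (F.P p.K) k (SU N) => noExpIntegrandAt F N (FluctV N) p.K k W
        (tkBranchOfRecord F N (FluctV N) θ.ν θ.τ9.M _ p.K W s.init S k
          (fun ω => sect2Operand F N (FluctV N) p.K (settingOfRecord₁₃ F N θ p) Rz' s t E₀ (UbgOfRecord₁₃CoP F N θ p (k + 1) s)
            (S, fun j => (ω j).2) (fun j => (ω j).1)))
        ((avOfRecord F N p.K k).avg U₀) U₀) (fieldMeasure (F.P p.K) k (SU N))) :
    slotsTOfRecord F N θ.ν θ.τ9 (EOfRecord₁₃ F N θ) (wOfRecord₉ F N θ.toStage9Params) θ.ppSel p (gOfRecord₁₃ F N θ p) (k + 1) s = 0 ∨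
      ∀ᵐ V' ∂fieldMeasure (F.P p.K) (k + 1) (SU N),
        chiSeqOfRecord F N θ.ν θ.τ9.M (gOfRecord₁₃ F N θ p) p.K (k + 1) s V' ≠ 0 →
          slotsTOfRecord F N θ.ν θ.τ9 (EOfRecord₁₃ F N θ) (wOfRecord₉ F N θ.toStage9Params) θ.ppSel p
              (gOfRecord₁₃ F N θ p) (k + 1) s V' =
            sect2Slot F N (FluctV N) p.K (settingOfRecord₁₃ F N θ p) Rz' W s t E₀ (UbgOfRecord₁₃CoP F N θ p (k + 1) s) V' := by
  have hsl : sect2Slot F N (FluctV N) p.K (settingOfRecord₁₃ F N θ p) Rz W₀ s.init t E₀ (UbgOfRecord₁₃CoP F N θ p k s.init) =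
      sect2Slot F N (FluctV N) p.K (settingOfRecord₁₃ F N θ p) Rz W s.init t E₀ (UbgOfRecord₁₃CoP F N θ p k s.init) :=
    (sect2Slot_congr_of_weights θ.ν θ.τ9.M (gOfRecord₁₃ F N θ p) p.K _ Rz W W₀ s.init t E₀ _ (fun j hj => (hpre j hj).1) (fun j hj => (hpre j hj).2)).symm
  simp only [hsl] at hid
  exact clause_succ_of_Omega_empty_of_pinChi_of_clause_of_integrable θ p hk hM s hΩ W hζloc hwloc Rz Rz' t E₀ hA hid hζχ hm hI


end GenericW

end Summit.QuantumFields.YangMills.Theorems.BalabanUVNodesN11NoExpansionGenericWIntegrable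

end
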